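import Summits.QuantumFields.YangMills.Theses.ModerateWindow
import Literature.MathematicalPhysics.QuantumFieldTheory.Balaban1983to89.T4PairDerivBridge

/-!
# Route `ModerateWindow` — THE REGISTERED SPLIT OF CRUX `WindowMGFL` IS LOSSLESS:
# `WindowMGFL ↔ stub_fineWindow ∧ stub_deepWindow` (structure probe of the two analytic stubs of
# `Cruxes/HistoryTailL/Lines/moderate_window.lean`, the registered line of crux `HistoryTailL` = stmt-QuantumFields-19936 since
# 2026-08-28T12:37Z; width seat ym-ust-19936-w5 g6; helper, no stub is claimed or proved)

THE POINT.  The registered skeleton splits the route crux `WindowMGFL` (stmt-QuantumFields-27839: the windowed sub-Gaussian moment bound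
`∫ exp(t·dist1(Ū^j(∂p))/g_(K−j)) dGibbs_K ≤ D·β_(K−j)^A·e^(H t²)` for `0 ≤ t ≤ β_(K−j)^ε`) into two REGIME stubs — `stub_fineWindow`
(heights `2j ≤ K`) and `stub_deepWindow` (`K < 2j`) — each stated in a «MONOTONE-CLOSURE» quantifier form
`∀ L ∃ ε₀ ∀ ε ≤ ε₀ ∃ γ₁ ∀ (F, γ) ∃ H₀ ∀ H ≥ H₀ ∃ A₀ ∀ A ≥ A₀ ∃ D …` (instead of the crux's plain `∃ ε … ∃ (H, D, A)`), so that the join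
`WindowMGFL_of` of the skeleton is pure logic.  A triager's first question is whether that closure form makes a stub STRONGER than the crux
(then a true crux could sit behind a false stub).  This file answers NO by kernel:

* `closure_of_simple` — for ANY left-hand side `I F γ K j p t` and ANY regime predicate `R K j`, the plain form implies the closure form,
  because the running inverse coupling satisfies `β_(K−j) = (γ·L^(−(K−j)))⁻¹ ≥ 1` (as in `ModerateWindowNesting.one_le_beta`), so the bound `D·β^A·e^(H t²)` on the
  window `t ≤ β^ε` is MONOTONE: weaker for smaller `ε` (smaller window, `Real.rpow_le_rpow_of_exponent_le`), larger `H` and larger `A`;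
  `simple_of_closure` is the trivial converse (instantiate at `ε₀, H₀, A₀`);
* **`fineWindow_of_windowMGFL`**, **`deepWindow_of_windowMGFL`** — `WindowMGFL` implies EACH registered stub, signature VERBATIM
  (drop the regime hypothesis, then `closure_of_simple`);
* `windowMGFL_of_fineWindow_of_deepWindow` — the skeleton's composition direction (case split `2j ≤ K ∨ K < 2j`, constants `min ε`, `min γ₁`,
  `max H`, `max A`, `max D`), restated here because `Cruxes/` line files are not importable modules;
* **`windowMGFL_iff_fineWindow_and_deepWindow`** — hence `WindowMGFL ↔ stub_fineWindow ∧ stub_deepWindow`: the split is LOSSLESS;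
* §4 `integral_exp_mul_le_exp_beta` — WHERE THE CONTENT SITS: unconditionally `∫ exp(t·Y) dGibbs_K ≤ exp(β_(K−j)/H)·e^(H t²)` for all
  `t ≥ 0`, `H > 0` (`dist1 ≤ 2`, `1/g_n = √β_n`, AM–GM), so at every FIXED height `n = K − j` the windowed bound is trivially true
  uniformly in `K` (`D = exp(β_n/H)`, `A = 0`); **`windowMGFL_of_eventually`** — therefore `WindowMGFL` follows from its EVENTUAL-IN-HEIGHT
  version (one `(H, D, A)` for all heights `≥ n₀(F, γ)`): the crux and both stubs are statements about the limit `n → ∞` ONLY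
  (`β_n = Lⁿ/γ → ∞`), and a refutation must exhibit a height SEQUENCE.

CONSEQUENCES (for the line's disprover / tribunal / stub provers): (i) a `stub-false` witness against EITHER stub refutes the crux `WindowMGFL`
itself (and, by `ModerateWindowNesting.orliczTailL_of_windowMGFL`, is NOT informative about `StretchedTail.OrliczTailL`); (ii) neither stub is
misstated-as-stronger relative to the crux; (iii) a prover of a stub may prove the PLAIN form on its regime and finish with `closure_of_simple`.

WHAT THIS IS NOT: no moment bound under the Wilson–Gibbs law `gibbsK` is proved; both stubs, the crux `WindowMGFL`, the crux `HistoryTailL`,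
the rung-R3 leaf `YM3TorusSU2`, d = 4, the continuum limit and the Yang–Mills mass gap stay OPEN.  YM₃ on the three-torus is rung R3 of the
programme, NOT the Clay problem.

References: T. Bałaban, CMP 102 (1985) 255–275 [Balaban1985UV3] ((1)–(3) p.256: `β = (g²ε)⁻¹ ≥ 1`; (71) p.273).
-/

noncomputable section

open MeasureTheory
open Literature.MathematicalPhysics.QuantumFieldTheory.Balaban1983to89
open Literature.MathematicalPhysics.QuantumFieldTheory.Balaban1983to89.T3ContinuumYM3Torus
open Literature.MathematicalPhysics.QuantumFieldTheory.Balaban1983to89.T3UnitScaleTilt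
open Literature.MathematicalPhysics.QuantumFieldTheory.Balaban1983to89.T3UnitLawDensityEML
open Literature.MathematicalPhysics.QuantumFieldTheory.Balaban1983to89.T4PairDerivBridge (dist1_le_two_specialUnitaryGroup)

namespace Summit.QuantumFields.YangMills.Theorems.ModerateWindowStubsOfWindowMGFL

/-! ## §1 Monotone closure in `(ε, H, A)` — generic in the left-hand side `I` and the regime `R` -/

/-- **MONOTONICITY OF THE WINDOWED BOUND.**  For `0 < γ ≤ 1` (so `β_(K−j) ≥ 1`): if a quantity is `≤ D·β^A·e^(H t²)` as soon as
`t ≤ β^ε`, then it is `≤ D·β^(A')·e^(H' t²)` as soon as `t ≤ β^(ε')`, whenever `ε' ≤ ε`, `H ≤ H'`, `A ≤ A'` and `0 ≤ D`.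
[cite: Balaban1985UV3, (1)-(3) p.256] -/
theorem windowBound_mono (F : T3Family) {γ : ℝ} (hγ : 0 < γ) (hγ1 : γ ≤ 1) {ε ε' H H' D : ℝ} {A A' : ℕ} (hD : 0 ≤ D)
    (hε : ε' ≤ ε) (hH : H ≤ H') (hA : A ≤ A') (n : ℕ) {x t : ℝ}
    (ht : t ≤ (F.scheme ℰp γ).β n ^ ε')
    (hbound : t ≤ (F.scheme ℰp γ).β n ^ ε → x ≤ D * (F.scheme ℰp γ).β n ^ A * Real.exp (H * t ^ 2)) :
    x ≤ D * (F.scheme ℰp γ).β n ^ A' * Real.exp (H' * t ^ 2) := by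
  -- `β_n = (γ·L^(−n))⁻¹ ≥ 1` (the tree's `ModerateWindowNesting.one_le_beta`, inlined to keep this file inside ONE route cone)
  have hβ1 : 1 ≤ (F.scheme ℰp γ).β n := by
    have hL : (1 : ℝ) ≤ F.L := by exact_mod_cast F.hL.2.le
    have hLi0 : 0 < ((F.L : ℝ)⁻¹) ^ n := pow_pos (inv_pos.mpr (by linarith)) n
    have hLi1 : ((F.L : ℝ)⁻¹) ^ n ≤ 1 := pow_le_one₀ (inv_nonneg.mpr (by linarith)) (inv_le_one_of_one_le₀ hL)
    show 1 ≤ (γ * ((F.L : ℝ)⁻¹) ^ n)⁻¹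
    exact (one_le_inv₀ (mul_pos hγ hLi0)).mpr (mul_le_one₀ hγ1 hLi0.le hLi1)
  have ht' : t ≤ (F.scheme ℰp γ).β n ^ ε := ht.trans (Real.rpow_le_rpow_of_exponent_le hβ1 hε)
  refine (hbound ht').trans ?_
  have hβA : (F.scheme ℰp γ).β n ^ A ≤ (F.scheme ℰp γ).β n ^ A' := pow_le_pow_right₀ hβ1 hA
  have hexp : Real.exp (H * t ^ 2) ≤ Real.exp (H' * t ^ 2) :=
    Real.exp_le_exp.mpr (mul_le_mul_of_nonneg_right hH (sq_nonneg t))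
  exact mul_le_mul (mul_le_mul_of_nonneg_left hβA hD) hexp (Real.exp_pos _).le
    (mul_nonneg hD (pow_nonneg (zero_le_one.trans hβ1) _))

/-- **PLAIN FORM ⟹ MONOTONE-CLOSURE FORM** (generic left-hand side `I`, generic regime `R`).  If for every `L` there are ONE window
exponent `ε`, a threshold `γ₁ ≤ 1` and, per family and coupling, ONE triple `(H, D, A)` bounding `I` on the regime `R`, then the closure
form of the registered stubs holds: `ε₀ := ε` works for every `ε' ≤ ε₀`, `H₀ := H` for every `H' ≥ H₀`, `A₀ := A` for every `A' ≥ A₀`, with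
the same `D` — by `windowBound_mono`. [cite: Balaban1985UV3, (1)-(3) p.256] -/
theorem closure_of_simple (I : ∀ (F : T3Family) (γ : ℝ) (K j : ℕ), Plaq (F.P K) j → ℝ → ℝ) (R : ℕ → ℕ → Prop)
    (h : ∀ (L : ℕ), ∃ ε : ℝ, 0 < ε ∧ ∃ γ₁ : ℝ, 0 < γ₁ ∧ γ₁ ≤ 1 ∧ ∀ (F : T3Family) (γ : ℝ), F.L = L → 0 < γ → γ ≤ γ₁ →
      ∃ (H D : ℝ) (A : ℕ), 0 < H ∧ 0 ≤ D ∧ ∀ (K j : ℕ), 1 ≤ j → j ≤ K → R K j → ∀ (p : Plaq (F.P K) j) (t : ℝ), 0 ≤ t →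
        t ≤ (F.scheme ℰp γ).β (K - j) ^ ε → I F γ K j p t ≤ D * (F.scheme ℰp γ).β (K - j) ^ A * Real.exp (H * t ^ 2)) :
    ∀ (L : ℕ), ∃ ε₀ : ℝ, 0 < ε₀ ∧ ∀ (ε : ℝ), 0 < ε → ε ≤ ε₀ → ∃ γ₁ : ℝ, 0 < γ₁ ∧ γ₁ ≤ 1 ∧ ∀ (F : T3Family) (γ : ℝ), F.L = L →
      0 < γ → γ ≤ γ₁ → ∃ H₀ : ℝ, 0 < H₀ ∧ ∀ (H : ℝ), H₀ ≤ H → ∃ A₀ : ℕ, ∀ (A : ℕ), A₀ ≤ A → ∃ D : ℝ, 0 ≤ D ∧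
        ∀ (K j : ℕ), 1 ≤ j → j ≤ K → R K j → ∀ (p : Plaq (F.P K) j) (t : ℝ), 0 ≤ t → t ≤ (F.scheme ℰp γ).β (K - j) ^ ε →
          I F γ K j p t ≤ D * (F.scheme ℰp γ).β (K - j) ^ A * Real.exp (H * t ^ 2) := by
  intro L
  obtain ⟨ε₀, hε₀, γ₁, hγ₁, hγ₁1, hF⟩ := h L
  refine ⟨ε₀, hε₀, fun ε _ hεle => ⟨γ₁, hγ₁, hγ₁1, fun F γ hFL hγ hγle => ?_⟩⟩
  obtain ⟨H, D, A, hH, hD, hB⟩ := hF F γ hFL hγ hγle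
  refine ⟨H, hH, fun H' hH' => ⟨A, fun A' hA' => ⟨D, hD, fun K j hj hjK hR p t ht0 ht => ?_⟩⟩⟩
  exact windowBound_mono F hγ (hγle.trans hγ₁1) hD hεle hH' hA' (K - j) ht
    (fun ht' => hB K j hj hjK hR p t ht0 ht')

/-- **MONOTONE-CLOSURE FORM ⟹ PLAIN FORM** (trivial converse: instantiate at `ε₀`, `H₀`, `A₀`). [folklore] -/
theorem simple_of_closure (I : ∀ (F : T3Family) (γ : ℝ) (K j : ℕ), Plaq (F.P K) j → ℝ → ℝ) (R : ℕ → ℕ → Prop)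
    (h : ∀ (L : ℕ), ∃ ε₀ : ℝ, 0 < ε₀ ∧ ∀ (ε : ℝ), 0 < ε → ε ≤ ε₀ → ∃ γ₁ : ℝ, 0 < γ₁ ∧ γ₁ ≤ 1 ∧ ∀ (F : T3Family) (γ : ℝ), F.L = L →
      0 < γ → γ ≤ γ₁ → ∃ H₀ : ℝ, 0 < H₀ ∧ ∀ (H : ℝ), H₀ ≤ H → ∃ A₀ : ℕ, ∀ (A : ℕ), A₀ ≤ A → ∃ D : ℝ, 0 ≤ D ∧
        ∀ (K j : ℕ), 1 ≤ j → j ≤ K → R K j → ∀ (p : Plaq (F.P K) j) (t : ℝ), 0 ≤ t → t ≤ (F.scheme ℰp γ).β (K - j) ^ ε →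
          I F γ K j p t ≤ D * (F.scheme ℰp γ).β (K - j) ^ A * Real.exp (H * t ^ 2)) :
    ∀ (L : ℕ), ∃ ε : ℝ, 0 < ε ∧ ∃ γ₁ : ℝ, 0 < γ₁ ∧ γ₁ ≤ 1 ∧ ∀ (F : T3Family) (γ : ℝ), F.L = L → 0 < γ → γ ≤ γ₁ →
      ∃ (H D : ℝ) (A : ℕ), 0 < H ∧ 0 ≤ D ∧ ∀ (K j : ℕ), 1 ≤ j → j ≤ K → R K j → ∀ (p : Plaq (F.P K) j) (t : ℝ), 0 ≤ t →
        t ≤ (F.scheme ℰp γ).β (K - j) ^ ε → I F γ K j p t ≤ D * (F.scheme ℰp γ).β (K - j) ^ A * Real.exp (H * t ^ 2) := by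
  intro L
  obtain ⟨ε₀, hε₀, hε⟩ := h L
  obtain ⟨γ₁, hγ₁, hγ₁1, hF⟩ := hε ε₀ hε₀ le_rfl
  refine ⟨ε₀, hε₀, γ₁, hγ₁, hγ₁1, fun F γ hFL hγ hγle => ?_⟩
  obtain ⟨H₀, hH₀, hH⟩ := hF F γ hFL hγ hγle
  obtain ⟨A₀, hA⟩ := hH H₀ le_rfl
  obtain ⟨D, hD, hB⟩ := hA A₀ le_rfl
  exact ⟨H₀, D, A₀, hH₀, hD, hB⟩

/-! ## §2 The crux implies each registered stub (signatures verbatim) -/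

/-- **`WindowMGFL ⟹ stub_fineWindow`** (the fine-regime stub of `Lines/moderate_window.lean`, signature VERBATIM): drop the regime
hypothesis `2j ≤ K`, then close monotonically in `(ε, H, A)`. [cite: Balaban1985UV3, (71) p.273] -/
theorem fineWindow_of_windowMGFL (h : Summit.QuantumFields.YangMills.Theses.ModerateWindow.WindowMGFL) :
    ∀ (L : ℕ), ∃ ε₀ : ℝ, 0 < ε₀ ∧ ∀ (ε : ℝ), 0 < ε → ε ≤ ε₀ → ∃ γ₁ : ℝ, 0 < γ₁ ∧ γ₁ ≤ 1 ∧ ∀ (F : T3Family) (γ : ℝ), F.L = L → 0 < γ → γ ≤ γ₁ → ∃ H₀ : ℝ, 0 < H₀ ∧ ∀ (H : ℝ), H₀ ≤ H → ∃ A₀ : ℕ, ∀ (A : ℕ), A₀ ≤ A → ∃ D : ℝ, 0 ≤ D ∧ ∀ (K j : ℕ), 1 ≤ j → j ≤ K → 2 * j ≤ K → ∀ (p : Plaq (F.P K) j) (t : ℝ), 0 ≤ t → t ≤ (F.scheme T3UnitLawDensityEML.ℰp γ).β (K - j) ^ ε → ∫ U, Real.exp (t * (GaugeGroup.dist1 (GaugeField.plaqHol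 (Averaging.iter (fun i => BlockAveraging.blockAvg (P := F.P K) (j := i) T3UnitLawDensityEML.ℰp) j U) p) / Real.sqrt (γ * ((F.L : ℝ)⁻¹) ^ (K - j)))) ∂(T3UnitScaleTilt.gibbsK F T3UnitLawDensityEML.ℰp γ K) ≤ D * (F.scheme T3UnitLawDensityEML.ℰp γ).β (K - j) ^ A * Real.exp (H * t ^ 2) := by
  refine closure_of_simple (fun F γ K j p t => ∫ U, Real.exp (t * (GaugeGroup.dist1 (GaugeField.plaqHol
      (Averaging.iter (fun i => BlockAveraging.blockAvg (P := F.P K) (j := i) ℰp) j U) p) / Real.sqrt (γ * ((F.L : ℝ)⁻¹) ^ (K - j))))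
        ∂(gibbsK F ℰp γ K)) (fun K j => 2 * j ≤ K) fun L => ?_
  obtain ⟨ε, hε, γ₁, hγ₁, hγ₁1, hF⟩ := h L
  refine ⟨ε, hε, γ₁, hγ₁, hγ₁1, fun F γ hFL hγ hγle => ?_⟩
  obtain ⟨H, D, A, hH, hD, hB⟩ := hF F γ hFL hγ hγle
  exact ⟨H, D, A, hH, hD, fun K j hj hjK _ p t ht0 ht => hB K j hj hjK p t ht0 ht⟩

/-- **`WindowMGFL ⟹ stub_deepWindow`** (the deep-regime stub of `Lines/moderate_window.lean`, signature VERBATIM): drop the regime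
hypothesis `K < 2j`, then close monotonically in `(ε, H, A)`. [cite: Balaban1985UV3, (71) p.273] -/
theorem deepWindow_of_windowMGFL (h : Summit.QuantumFields.YangMills.Theses.ModerateWindow.WindowMGFL) :
    ∀ (L : ℕ), ∃ ε₀ : ℝ, 0 < ε₀ ∧ ∀ (ε : ℝ), 0 < ε → ε ≤ ε₀ → ∃ γ₁ : ℝ, 0 < γ₁ ∧ γ₁ ≤ 1 ∧ ∀ (F : T3Family) (γ : ℝ), F.L = L → 0 < γ → γ ≤ γ₁ → ∃ H₀ : ℝ, 0 < H₀ ∧ ∀ (H : ℝ), H₀ ≤ H → ∃ A₀ : ℕ, ∀ (A : ℕ), A₀ ≤ A → ∃ D : ℝ, 0 ≤ D ∧ ∀ (K j : ℕ), 1 ≤ j → j ≤ K → K < 2 * j → ∀ (p : Plaq (F.P K) j) (t : ℝ), 0 ≤ t → t ≤ (F.scheme T3UnitLawDensityEML.ℰp γ).β (K - j) ^ ε → ∫ U, Real.exp (t * (GaugeGroup.dist1 (GaugeField.plaqHol (Averaging.iter (fun i => BlockAveraging.blockAvg (P := F.P K) (j := i) T3UnitLawDensityEML.ℰp) j U) p)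 / Real.sqrt (γ * ((F.L : ℝ)⁻¹) ^ (K - j)))) ∂(T3UnitScaleTilt.gibbsK F T3UnitLawDensityEML.ℰp γ K) ≤ D * (F.scheme T3UnitLawDensityEML.ℰp γ).β (K - j) ^ A * Real.exp (H * t ^ 2) := by
  refine closure_of_simple (fun F γ K j p t => ∫ U, Real.exp (t * (GaugeGroup.dist1 (GaugeField.plaqHol
      (Averaging.iter (fun i => BlockAveraging.blockAvg (P := F.P K) (j := i) ℰp) j U) p) / Real.sqrt (γ * ((F.L : ℝ)⁻¹) ^ (K - j))))
        ∂(gibbsK F ℰp γ K)) (fun K j => K < 2 * j) fun L => ?_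
  obtain ⟨ε, hε, γ₁, hγ₁, hγ₁1, hF⟩ := h L
  refine ⟨ε, hε, γ₁, hγ₁, hγ₁1, fun F γ hFL hγ hγle => ?_⟩
  obtain ⟨H, D, A, hH, hD, hB⟩ := hF F γ hFL hγ hγle
  exact ⟨H, D, A, hH, hD, fun K j hj hjK _ p t ht0 ht => hB K j hj hjK p t ht0 ht⟩

/-! ## §3 The converse (the skeleton's composition) and the equivalence -/

/-- **`stub_fineWindow ⟹ stub_deepWindow ⟹ WindowMGFL`** — the composition `WindowMGFL_of` of the registered skeleton
`Cruxes/HistoryTailL/Lines/moderate_window.lean` (ideator seat ym-r3-idea-2 g4), restated verbatim as an importable theorem: take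
`min ε₁ ε₂`, `min γ₁ γ₂`, the common `H := max`, `A := max`, and `max D₁ D₂`; split on `2j ≤ K`. [cite: Balaban1985UV3, (71) p.273] -/
theorem windowMGFL_of_fineWindow_of_deepWindow
    (h₁ : ∀ (L : ℕ), ∃ ε₀ : ℝ, 0 < ε₀ ∧ ∀ (ε : ℝ), 0 < ε → ε ≤ ε₀ → ∃ γ₁ : ℝ, 0 < γ₁ ∧ γ₁ ≤ 1 ∧ ∀ (F : T3Family) (γ : ℝ), F.L = L → 0 < γ → γ ≤ γ₁ → ∃ H₀ : ℝ, 0 < H₀ ∧ ∀ (H : ℝ), H₀ ≤ H → ∃ A₀ : ℕ, ∀ (A : ℕ), A₀ ≤ A → ∃ D : ℝ, 0 ≤ D ∧ ∀ (K j : ℕ), 1 ≤ j → j ≤ K → 2 * j ≤ K → ∀ (p : Plaq (F.P K) j) (t : ℝ), 0 ≤ t → t ≤ (F.scheme T3UnitLawDensityEML.ℰp γ).β (K - j) ^ ε → ∫ U, Real.exp (t * (GaugeGroup.dist1 (GaugeField.plaqHol (Averaging.iter (fun i => BlockAveraging.blockAvg (P := F.P K) (j := i) T3UnitLawDensityEML.ℰp)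 j U) p) / Real.sqrt (γ * ((F.L : ℝ)⁻¹) ^ (K - j)))) ∂(T3UnitScaleTilt.gibbsK F T3UnitLawDensityEML.ℰp γ K) ≤ D * (F.scheme T3UnitLawDensityEML.ℰp γ).β (K - j) ^ A * Real.exp (H * t ^ 2))
    (h₂ : ∀ (L : ℕ), ∃ ε₀ : ℝ, 0 < ε₀ ∧ ∀ (ε : ℝ), 0 < ε → ε ≤ ε₀ → ∃ γ₁ : ℝ, 0 < γ₁ ∧ γ₁ ≤ 1 ∧ ∀ (F : T3Family) (γ : ℝ), F.L = L → 0 < γ → γ ≤ γ₁ → ∃ H₀ : ℝ, 0 < H₀ ∧ ∀ (H : ℝ), H₀ ≤ H → ∃ A₀ : ℕ, ∀ (A : ℕ), A₀ ≤ A → ∃ D : ℝ, 0 ≤ D ∧ ∀ (K j : ℕ), 1 ≤ j → j ≤ K → K < 2 * j → ∀ (p : Plaq (F.P K) j) (t : ℝ), 0 ≤ t → t ≤ (F.scheme T3UnitLawDensityEML.ℰp γ).β (K - j) ^ ε → ∫ U, Real.exp (t * (GaugeGroup.dist1 (GaugeField.plaqHol (Averaging.iter (fun i => BlockAveraging.blockAvg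 (P := F.P K) (j := i) T3UnitLawDensityEML.ℰp) j U) p) / Real.sqrt (γ * ((F.L : ℝ)⁻¹) ^ (K - j)))) ∂(T3UnitScaleTilt.gibbsK F T3UnitLawDensityEML.ℰp γ K) ≤ D * (F.scheme T3UnitLawDensityEML.ℰp γ).β (K - j) ^ A * Real.exp (H * t ^ 2)) :
    Summit.QuantumFields.YangMills.Theses.ModerateWindow.WindowMGFL := by
  -- adapted from the registered skeleton `Cruxes/HistoryTailL/Lines/moderate_window.lean` (`WindowMGFL_of`)
  intro L
  obtain ⟨ε₁, hε₁, H₁⟩ := h₁ L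
  obtain ⟨ε₂, hε₂, H₂⟩ := h₂ L
  have hε : 0 < min ε₁ ε₂ := lt_min hε₁ hε₂
  obtain ⟨γ₁, hγ₁, hγ₁1, G₁⟩ := H₁ (min ε₁ ε₂) hε (min_le_left _ _)
  obtain ⟨γ₂, hγ₂, _, G₂⟩ := H₂ (min ε₁ ε₂) hε (min_le_right _ _)
  refine ⟨min ε₁ ε₂, hε, min γ₁ γ₂, lt_min hγ₁ hγ₂, (min_le_left _ _).trans hγ₁1, ?_⟩
  intro F γ hF hγ hγle
  obtain ⟨C₁, hC₁, K₁⟩ := G₁ F γ hF hγ (hγle.trans (min_le_left _ _))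
  obtain ⟨C₂, hC₂, K₂⟩ := G₂ F γ hF hγ (hγle.trans (min_le_right _ _))
  obtain ⟨A₁, M₁⟩ := K₁ (max C₁ C₂) (le_max_left _ _)
  obtain ⟨A₂, M₂⟩ := K₂ (max C₁ C₂) (le_max_right _ _)
  obtain ⟨D₁, hD₁, B₁⟩ := M₁ (max A₁ A₂) (le_max_left _ _)
  obtain ⟨D₂, hD₂, B₂⟩ := M₂ (max A₁ A₂) (le_max_right _ _)
  refine ⟨max C₁ C₂, max D₁ D₂, max A₁ A₂, lt_max_of_lt_left hC₁, le_max_of_le_left hD₁, ?_⟩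
  intro K j hj hjK p t ht0 ht
  have hβ : 0 ≤ (F.scheme ℰp γ).β (K - j) ^ max A₁ A₂ * Real.exp (max C₁ C₂ * t ^ 2) :=
    mul_nonneg (pow_nonneg (F.scheme_β_nonneg _ hγ.le _) _) (Real.exp_nonneg _)
  by_cases hreg : 2 * j ≤ K
  · have hle := B₁ K j hj hjK hreg p t ht0 ht
    calc _ ≤ _ := hle
      _ ≤ _ := by rw [mul_assoc, mul_assoc]; exact mul_le_mul_of_nonneg_right (le_max_left _ _) hβ
  · have hle := B₂ K j hj hjK (Nat.lt_of_not_le hreg) p t ht0 ht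
    calc _ ≤ _ := hle
      _ ≤ _ := by rw [mul_assoc, mul_assoc]; exact mul_le_mul_of_nonneg_right (le_max_right _ _) hβ

/-- **THE SPLIT IS LOSSLESS: `WindowMGFL ↔ stub_fineWindow ∧ stub_deepWindow`** (both registered stub signatures verbatim).  So a
refutation of either regime stub refutes the crux itself, and neither stub is stronger than the crux. [cite: Balaban1985UV3, (71) p.273] -/
theorem windowMGFL_iff_fineWindow_and_deepWindow :
    Summit.QuantumFields.YangMills.Theses.ModerateWindow.WindowMGFL ↔
      ((∀ (L : ℕ), ∃ ε₀ : ℝ, 0 < ε₀ ∧ ∀ (ε : ℝ), 0 < ε → ε ≤ ε₀ → ∃ γ₁ : ℝ, 0 < γ₁ ∧ γ₁ ≤ 1 ∧ ∀ (F : T3Family) (γ : ℝ), F.L = L → 0 < γ → γ ≤ γ₁ → ∃ H₀ : ℝ, 0 < H₀ ∧ ∀ (H : ℝ), H₀ ≤ H → ∃ A₀ : ℕ, ∀ (A : ℕ), A₀ ≤ A → ∃ D : ℝ, 0 ≤ D ∧ ∀ (K j : ℕ), 1 ≤ j → j ≤ K → 2 * j ≤ K → ∀ (p : Plaq (F.P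 K) j) (t : ℝ), 0 ≤ t → t ≤ (F.scheme T3UnitLawDensityEML.ℰp γ).β (K - j) ^ ε → ∫ U, Real.exp (t * (GaugeGroup.dist1 (GaugeField.plaqHol (Averaging.iter (fun i => BlockAveraging.blockAvg (P := F.P K) (j := i) T3UnitLawDensityEML.ℰp) j U) p) / Real.sqrt (γ * ((F.L : ℝ)⁻¹) ^ (K - j)))) ∂(T3UnitScaleTilt.gibbsK F T3UnitLawDensityEML.ℰp γ K) ≤ D * (F.scheme T3UnitLawDensityEML.ℰp γ).β (K - j) ^ A * Real.exp (H * t ^ 2)) ∧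
       (∀ (L : ℕ), ∃ ε₀ : ℝ, 0 < ε₀ ∧ ∀ (ε : ℝ), 0 < ε → ε ≤ ε₀ → ∃ γ₁ : ℝ, 0 < γ₁ ∧ γ₁ ≤ 1 ∧ ∀ (F : T3Family) (γ : ℝ), F.L = L → 0 < γ → γ ≤ γ₁ → ∃ H₀ : ℝ, 0 < H₀ ∧ ∀ (H : ℝ), H₀ ≤ H → ∃ A₀ : ℕ, ∀ (A : ℕ), A₀ ≤ A → ∃ D : ℝ, 0 ≤ D ∧ ∀ (K j : ℕ), 1 ≤ j → j ≤ K → K < 2 * j → ∀ (p : Plaq (F.P K) j) (t : ℝ), 0 ≤ t → t ≤ (F.scheme T3UnitLawDensityEML.ℰp γ).β (K - j) ^ ε → ∫ U, Real.exp (t * (GaugeGroup.dist1 (GaugeField.plaqHol (Averaging.iter (fun i => BlockAveraging.blockAvg (P := F.P K) (j := i) T3UnitLawDensityEML.ℰp) j U) p) / Real.sqrt (γ * ((F.L : ℝ)⁻¹) ^ (K - j)))) ∂(T3UnitScaleTilt.gibbsK F T3UnitLawDensityEML.ℰp γ K) ≤ D * (F.scheme T3UnitLawDensityEML.ℰp γ).β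 (K - j) ^ A * Real.exp (H * t ^ 2))) :=
  ⟨fun h => ⟨fineWindow_of_windowMGFL h, deepWindow_of_windowMGFL h⟩,
    fun h => windowMGFL_of_fineWindow_of_deepWindow h.1 h.2⟩

/-! ## §4 Where the content sits: the windowed bound is TRIVIAL at bounded height — only height-uniformity is asked -/

/-- AM–GM plumbing: `t·(d/g) ≤ H·t² + (g⁻¹)²/H` for `d ≤ 2`, `0 < g`, `0 ≤ t`, `0 < H`. [folklore] -/
theorem mul_div_le_of_le_two {d g t H : ℝ} (hd : d ≤ 2) (hg : 0 < g) (ht : 0 ≤ t) (hH : 0 < H) :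
    t * (d / g) ≤ H * t ^ 2 + g⁻¹ ^ 2 / H := by
  have hgi : 0 < g⁻¹ := inv_pos.mpr hg
  have h1 : t * (d / g) ≤ 2 * t * g⁻¹ := by
    rw [div_eq_mul_inv]
    nlinarith [mul_nonneg ht hgi.le]
  have h2 : H * t ^ 2 + g⁻¹ ^ 2 / H - 2 * t * g⁻¹ = (t * H - g⁻¹) ^ 2 / H := by
    field_simp
    ring
  have h3 : 0 ≤ H * t ^ 2 + g⁻¹ ^ 2 / H - 2 * t * g⁻¹ := by
    rw [h2]; positivity
  linarith

/-- The running inverse coupling is MONOTONE in the height: `β_n ≤ β_m` for `n ≤ m` (`β_n = (γ·L^(−n))⁻¹`, `L ≥ 1`, `γ > 0`).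
[cite: Balaban1985UV3, (1)-(3) p.256] -/
theorem scheme_β_mono (F : T3Family) {γ : ℝ} (hγ : 0 < γ) {n m : ℕ} (hnm : n ≤ m) :
    (F.scheme ℰp γ).β n ≤ (F.scheme ℰp γ).β m := by
  have hL : 1 ≤ F.L := F.hL.2.le
  have hL0 : 0 < F.L := hL
  have hLr : (0 : ℝ) < F.L := Nat.cast_pos.mpr hL0
  have hi0 : 0 ≤ (F.L : ℝ)⁻¹ := inv_nonneg.mpr hLr.le
  have hi1 : (F.L : ℝ)⁻¹ ≤ 1 := inv_le_one_of_one_le₀ (by exact_mod_cast hL)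
  show (γ * ((F.L : ℝ)⁻¹) ^ n)⁻¹ ≤ (γ * ((F.L : ℝ)⁻¹) ^ m)⁻¹
  have hxm : 0 < γ * ((F.L : ℝ)⁻¹) ^ m := mul_pos hγ (pow_pos (inv_pos.mpr hLr) m)
  have hxn : 0 < γ * ((F.L : ℝ)⁻¹) ^ n := mul_pos hγ (pow_pos (inv_pos.mpr hLr) n)
  exact (inv_le_inv₀ hxn hxm).mpr (mul_le_mul_of_nonneg_left (pow_le_pow_of_le_one hi0 hi1 hnm) hγ.le)

/-- **UNCONDITIONAL MOMENT BOUND AT EVERY HEIGHT** (`γ > 0`, `t ≥ 0`, `H > 0`; no window, no smallness):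
`∫ exp(t·dist1(Ū^j(∂p))/g_(K−j)) dGibbs_K ≤ exp(β_(K−j)/H)·exp(H·t²)` — because `dist1 ≤ 2` on `SU(2)` and `1/g_n = √β_n`, so
`t·Y ≤ 2t√β ≤ H t² + β/H`, and `Gibbs_K` is a probability measure.  So at any FIXED height `n = K − j` the crux's bound holds with
`D = exp(β_n/H)`, `A = 0`, uniformly in `K`: the whole content of `WindowMGFL` ∕ the two stubs is UNIFORMITY AS THE HEIGHT `n → ∞`
(`β_n = L^n/γ → ∞`). [cite: Balaban1985UV3, (1)-(3) p.256] -/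
theorem integral_exp_mul_le_exp_beta (F : T3Family) {γ : ℝ} (hγ : 0 < γ) (K j : ℕ) (p : Plaq (F.P K) j) {t H : ℝ}
    (ht : 0 ≤ t) (hH : 0 < H) :
    ∫ U, Real.exp (t * (GaugeGroup.dist1 (GaugeField.plaqHol (Averaging.iter
        (fun i => BlockAveraging.blockAvg (P := F.P K) (j := i) ℰp) j U) p) / Real.sqrt (γ * ((F.L : ℝ)⁻¹) ^ (K - j))))
        ∂(gibbsK F ℰp γ K) ≤ Real.exp ((F.scheme ℰp γ).β (K - j) / H) * Real.exp (H * t ^ 2) := by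
  haveI := isProbabilityMeasure_gibbsK F ℰp hγ.le K
  have hL : 1 ≤ F.L := F.hL.2.le
  have hL0 : 0 < F.L := hL
  have hLr : (0 : ℝ) < F.L := Nat.cast_pos.mpr hL0
  have hx0 : 0 < γ * ((F.L : ℝ)⁻¹) ^ (K - j) := mul_pos hγ (pow_pos (inv_pos.mpr hLr) _)
  have hg0 : 0 < Real.sqrt (γ * ((F.L : ℝ)⁻¹) ^ (K - j)) := Real.sqrt_pos.mpr hx0
  have hβ : (Real.sqrt (γ * ((F.L : ℝ)⁻¹) ^ (K - j)))⁻¹ ^ 2 = (F.scheme ℰp γ).β (K - j) := by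
    show _ = (γ * ((F.L : ℝ)⁻¹) ^ (K - j))⁻¹
    rw [inv_pow, Real.sq_sqrt hx0.le]
  have hpt : ∀ U : GaugeField (F.P K) 0 (Matrix.specialUnitaryGroup (Fin 2) ℂ),
      Real.exp (t * (GaugeGroup.dist1 (GaugeField.plaqHol (Averaging.iter
        (fun i => BlockAveraging.blockAvg (P := F.P K) (j := i) ℰp) j U) p) / Real.sqrt (γ * ((F.L : ℝ)⁻¹) ^ (K - j)))) ≤
        Real.exp ((F.scheme ℰp γ).β (K - j) / H) * Real.exp (H * t ^ 2) := fun U => by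
    rw [← Real.exp_add]
    refine Real.exp_le_exp.mpr ?_
    have key := mul_div_le_of_le_two (dist1_le_two_specialUnitaryGroup (GaugeField.plaqHol
      (Averaging.iter (fun i => BlockAveraging.blockAvg (P := F.P K) (j := i) ℰp) j U) p)) hg0 ht hH
    rw [hβ] at key
    linarith
  calc ∫ U, Real.exp (t * (GaugeGroup.dist1 (GaugeField.plaqHol (Averaging.iter
          (fun i => BlockAveraging.blockAvg (P := F.P K) (j := i) ℰp) j U) p) / Real.sqrt (γ * ((F.L : ℝ)⁻¹) ^ (K - j))))
          ∂(gibbsK F ℰp γ K)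
        ≤ ∫ _U, Real.exp ((F.scheme ℰp γ).β (K - j) / H) * Real.exp (H * t ^ 2) ∂(gibbsK F ℰp γ K) :=
          integral_mono_of_nonneg (ae_of_all _ fun U => (Real.exp_pos _).le) (integrable_const _) (ae_of_all _ hpt)
    _ = Real.exp ((F.scheme ℰp γ).β (K - j) / H) * Real.exp (H * t ^ 2) := by
          rw [integral_const, smul_eq_mul, probReal_univ, one_mul]

/-- **`WindowMGFL` FROM ITS EVENTUAL-IN-HEIGHT VERSION.**  If for every `L` there are `ε, γ₁` and, per family and coupling, a height
threshold `n₀` and ONE triple `(H, D, A)` such that the windowed bound holds at all heights `K − j ≥ n₀`, then `WindowMGFL` holds: the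
finitely many heights below `n₀` are covered by `integral_exp_mul_le_exp_beta` with the constant `exp(β_(n₀)/H)` (`β` monotone in the
height, `β^A ≥ 1`).  For the disprover: a refutation of `WindowMGFL` is necessarily a SEQUENCE of heights `n → ∞`, never one height.
[cite: Balaban1985UV3, (71) p.273] -/
theorem windowMGFL_of_eventually
    (h : ∀ (L : ℕ), ∃ ε : ℝ, 0 < ε ∧ ∃ γ₁ : ℝ, 0 < γ₁ ∧ γ₁ ≤ 1 ∧ ∀ (F : T3Family) (γ : ℝ), F.L = L → 0 < γ → γ ≤ γ₁ →
      ∃ (n₀ : ℕ) (H D : ℝ) (A : ℕ), 0 < H ∧ 0 ≤ D ∧ ∀ (K j : ℕ), 1 ≤ j → j ≤ K → n₀ ≤ K - j → ∀ (p : Plaq (F.P K) j) (t : ℝ),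
        0 ≤ t → t ≤ (F.scheme ℰp γ).β (K - j) ^ ε →
          ∫ U, Real.exp (t * (GaugeGroup.dist1 (GaugeField.plaqHol (Averaging.iter
            (fun i => BlockAveraging.blockAvg (P := F.P K) (j := i) ℰp) j U) p) / Real.sqrt (γ * ((F.L : ℝ)⁻¹) ^ (K - j))))
            ∂(gibbsK F ℰp γ K) ≤ D * (F.scheme ℰp γ).β (K - j) ^ A * Real.exp (H * t ^ 2)) :
    Summit.QuantumFields.YangMills.Theses.ModerateWindow.WindowMGFL := by
  intro L
  obtain ⟨ε, hε, γ₁, hγ₁, hγ₁1, hF⟩ := h L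
  refine ⟨ε, hε, γ₁, hγ₁, hγ₁1, fun F γ hFL hγ hγle => ?_⟩
  obtain ⟨n₀, H, D, A, hH, hD, hB⟩ := hF F γ hFL hγ hγle
  have hγ1 : γ ≤ 1 := hγle.trans hγ₁1
  refine ⟨H, max D (Real.exp ((F.scheme ℰp γ).β n₀ / H)), A, hH, le_max_of_le_left hD, ?_⟩
  intro K j hj hjK p t ht0 ht
  -- `β ≥ 1`, hence `β^A ≥ 1`
  have hβ1 : 1 ≤ (F.scheme ℰp γ).β (K - j) := by
    have hL : (1 : ℝ) ≤ F.L := by exact_mod_cast F.hL.2.le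
    have hLi0 : 0 < ((F.L : ℝ)⁻¹) ^ (K - j) := pow_pos (inv_pos.mpr (by linarith)) _
    have hLi1 : ((F.L : ℝ)⁻¹) ^ (K - j) ≤ 1 := pow_le_one₀ (inv_nonneg.mpr (by linarith)) (inv_le_one_of_one_le₀ hL)
    show 1 ≤ (γ * ((F.L : ℝ)⁻¹) ^ (K - j))⁻¹
    exact (one_le_inv₀ (mul_pos hγ hLi0)).mpr (mul_le_one₀ hγ1 hLi0.le hLi1)
  have hβA : 1 ≤ (F.scheme ℰp γ).β (K - j) ^ A := one_le_pow₀ hβ1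
  have hexp0 : 0 ≤ Real.exp (H * t ^ 2) := (Real.exp_pos _).le
  by_cases hn : n₀ ≤ K - j
  · refine (hB K j hj hjK hn p t ht0 ht).trans ?_
    have h0 : 0 ≤ (F.scheme ℰp γ).β (K - j) ^ A * Real.exp (H * t ^ 2) := mul_nonneg (zero_le_one.trans hβA) hexp0
    rw [mul_assoc, mul_assoc]
    exact mul_le_mul_of_nonneg_right (le_max_left _ _) h0
  · have hle : K - j ≤ n₀ := (Nat.lt_of_not_le hn).le
    refine (integral_exp_mul_le_exp_beta F hγ K j p ht0 hH).trans ?_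
    have hmono : Real.exp ((F.scheme ℰp γ).β (K - j) / H) ≤ max D (Real.exp ((F.scheme ℰp γ).β n₀ / H)) :=
      le_max_of_le_right (Real.exp_le_exp.mpr (div_le_div_of_nonneg_right (scheme_β_mono F hγ hle) hH.le))
    have hDm : 0 ≤ max D (Real.exp ((F.scheme ℰp γ).β n₀ / H)) := le_max_of_le_left hD
    calc Real.exp ((F.scheme ℰp γ).β (K - j) / H) * Real.exp (H * t ^ 2)
          ≤ max D (Real.exp ((F.scheme ℰp γ).β n₀ / H)) * 1 * Real.exp (H * t ^ 2) := by
            rw [mul_one]; exact mul_le_mul_of_nonneg_right hmono hexp0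
      _ ≤ max D (Real.exp ((F.scheme ℰp γ).β n₀ / H)) * (F.scheme ℰp γ).β (K - j) ^ A * Real.exp (H * t ^ 2) :=
            mul_le_mul_of_nonneg_right (mul_le_mul_of_nonneg_left hβA hDm) hexp0

end Summit.QuantumFields.YangMills.Theorems.ModerateWindowStubsOfWindowMGFL

end
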